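import Summits.ResolutionOfSingularities.ResolutionOfSingularities.Theorems.FrobeniusLadderFInjectiveMacaulayficationFullLastCentreSlack
import HarnessLib

/-!
# K10g — EQUI-ω CHAINS ARE TAME: along ANY chain of blow-ups of permissible coordinate centres Z (any dimension) that are ω-PERMISSIBLE at the base point
# (`ν_Z = ρ(x)`: the residual order is the same at x and at the generic point of Z), a drop point with the drop-point budget has `ρ ≤ 8` — kernel form of MC-8ᶜ for
# the equi-ω rules (R1/R3 of the bake-off; CJS-style ω-permissible centres), from an exceptional-free start; no other canonicity input
# (crux `FInjectiveMacaulayfication` stmt-ResolutionOfSingularities-15315, chain w45a; seat res-L1-w45a-lead-1 g16; builds on K10 `ordLE_iff`, K10e/K10f slack soundness)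

[OURS · L1 W4.5a] Support file (`--supports stmt-ResolutionOfSingularities-15315 --as helper`); replaces the role of NO printed item; NOT a statement of any manuscript;
proves nothing of the crux; OURS counted 0. AI-written (AI review is weaker than expert review).

MECHANISM. (i) THE EQUI-ω LAW (★ `ordLE_of_equi_step`): if `ν_Z = ρ` then `ρ′ ≤ ρ` at every chart origin (the minimal monomial of `N` has normal degree `ν`, so its
`L`-chart weight is `≤ ρ`; K10 `ordLE_iff`) — res-L1-w45a-idea-1ʼs «no rise under equi-ω arms», typed. (ii) While `ρ ≥ 9` an equi-ω step is HIGH-ORDER (`ν = ρ ≥ 9 > 8 ≥ 2|Nor|`),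
so non-positive slacks persist (K10f `allSlackLE_step`). Hence the invariant ★ `EquiTame := OrdLE N 8 ∨ AllSlackLE` is preserved by every equi-ω step
(★ `equiTame_step`), holds at an exceptional-free start, and at a budgeted drop point gives `ρ′ ≤ 8` (★ `ordLE_eight_of_equiTame_drop`: the law if `ρ ≤ 8`, K10f
`ordLE_eight_of_allSlackLE_drop` if `ρ ≥ 9`). ★★★ `equiChain_cap` assembles it along `EquiReachable` chains. Exponent bookkeeping only; no named fact; any field.
WHAT IT SAYS for the T-side: wildness (`ρ ≥ 9` at a drop point) on a chain from a FULL isolated triple point REQUIRES a centre that is NOT ω-permissible at its base point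
(`ν_Z < ρ(x)`: the #190 axis under rule (b), the permissive wild bedsʼ `ν = 2` sections, the R2/R2n «rises»); the equi-ω rules cannot produce it — within the letter
universe (chart origins, coordinate centres) and given the drop-point budget (R26.21 (β)).
-/

-- single-problem summit: the doubled namespace component is forced
set_option linter.dupNamespace false

noncomputable section

open MvPolynomial Finsupp
open Summit.ResolutionOfSingularities.ResolutionOfSingularities.Theorems.FInjectiveMacaulayfication.LastCentreDefs
open Summit.ResolutionOfSingularities.ResolutionOfSingularities.Theorems.FInjectiveMacaulayfication.LastCentreAxisOrder
open Summit.ResolutionOfSingularities.ResolutionOfSingularities.Theorems.FInjectiveMacaulayfication.LastCentreResidual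
open Summit.ResolutionOfSingularities.ResolutionOfSingularities.Theorems.FInjectiveMacaulayfication.LastCentreSlack

namespace Summit.ResolutionOfSingularities.ResolutionOfSingularities.Theorems.FInjectiveMacaulayfication.LastCentreEquiChain

variable {k : Type} [Field k]

/-- Normal degree is at most total degree. [plumbing] -/
theorem norDeg_le_tdeg (Nor : Finset Letter) (e : Expo) : norDeg Nor e ≤ tdeg e :=
  Finset.sum_le_sum_of_subset_of_nonneg (Finset.subset_univ Nor) fun _ _ _ => Nat.zero_le _

/-- ★ THE EQUI-ω LAW: if the centre is ω-permissible at the base point — some monomial of `N` has total degree equal to the minimal normal degree `ν` (i.e. `ρ = ν`) —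
then at every chart origin `ρ′ ≤ ν = ρ` (no rise). [OURS · L1 W4.5a] -/
theorem ordLE_of_equi_step {S S' : Stage k} {Nor : Finset Letter} {L : Letter} {α α' : Expo} {N N' : YPoly k} (hL : L ∈ Nor)
    (hch : IsChart S Nor L S') (hN : IsResidual S.Exc S.D α N) (hN' : IsResidual S'.Exc S'.D α' N')
    {ν : ℕ} (hν₁ : ∃ e ∈ N.support, norDeg Nor e = ν) (hν₂ : ∀ e ∈ N.support, ν ≤ norDeg Nor e)
    (hequi : ∃ e ∈ N.support, tdeg e = ν) : OrdLE N' ν := by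
  obtain ⟨e₀, he₀, hρ⟩ := hequi
  refine (ordLE_iff hL hch hN hN' hν₁ hν₂ ν).mpr ⟨e₀, he₀, ?_⟩
  have h1 : norDeg Nor e₀ ≤ tdeg e₀ := norDeg_le_tdeg Nor e₀
  have h2 : ν ≤ norDeg Nor e₀ := hν₂ e₀ he₀
  omega

/-- THE INVARIANT of equi-ω chains: `ρ ≤ 8` already, or all slacks non-positive. [OURS · L1 W4.5a] -/
def EquiTame (S : Stage k) (α : Expo) (N : YPoly k) : Prop :=
  OrdLE N 8 ∨ AllSlackLE S α

/-- ★ The invariant is PRESERVED by every equi-ω step (any dimension of the centre). [OURS · L1 W4.5a] -/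
theorem equiTame_step {S S' : Stage k} {Nor : Finset Letter} {L : Letter} {α α' : Expo} {N N' : YPoly k} (hL : L ∈ Nor)
    (hch : IsChart S Nor L S') (hN : IsResidual S.Exc S.D α N) (hN' : IsResidual S'.Exc S'.D α' N')
    {ν : ℕ} (hν₁ : ∃ e ∈ N.support, norDeg Nor e = ν) (hν₂ : ∀ e ∈ N.support, ν ≤ norDeg Nor e)
    (hequi : ∃ e ∈ N.support, tdeg e = ν) (hT : EquiTame S α N) : EquiTame S' α' N' := by
  by_cases h8 : ν ≤ 8
  · left
    obtain ⟨e, he, hd⟩ := ordLE_of_equi_step hL hch hN hN' hν₁ hν₂ hequi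
    exact ⟨e, he, hd.trans h8⟩
  rcases hT with hle | hslack
  · -- ρ ≤ 8 but ρ = ν ≥ 9: impossible (the minimal monomial has tdeg ≥ ν)
    exfalso
    obtain ⟨e, he, hd⟩ := hle
    have := hν₂ e he
    have := norDeg_le_tdeg Nor e
    omega
  · right
    have hcard : 2 * Nor.card ≤ ν := by
      have : Nor.card ≤ 4 := by simpa using Finset.card_le_univ Nor
      omega
    exact allSlackLE_step hL hch hN hN' hν₁ hν₂ hcard hslack

/-- ★ AT A DROP POINT reached by an equi-ω step from an `EquiTame` stage, the drop-point budget gives `ρ′ ≤ 8`. [OURS · L1 W4.5a] -/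
theorem ordLE_eight_of_equiTame_drop {S S' : Stage k} {Nor : Finset Letter} {L : Letter} {α α' : Expo} {N N' : YPoly k} (hL : L ∈ Nor)
    (hch : IsChart S Nor L S') (hN : IsResidual S.Exc S.D α N) (hN' : IsResidual S'.Exc S'.D α' N')
    {ν : ℕ} (hν₁ : ∃ e ∈ N.support, norDeg Nor e = ν) (hν₂ : ∀ e ∈ N.support, ν ≤ norDeg Nor e)
    (hequi : ∃ e ∈ N.support, tdeg e = ν) (hT : EquiTame S α N)
    (hbud : ∃ f ∈ S'.D.support, (tdeg f : ℤ) ≤ 8 + 2 * ∑ n ∈ S'.Exc, S'.d n) : OrdLE N' 8 := by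
  by_cases h8 : ν ≤ 8
  · obtain ⟨e, he, hd⟩ := ordLE_of_equi_step hL hch hN hN' hν₁ hν₂ hequi
    exact ⟨e, he, hd.trans h8⟩
  rcases hT with hle | hslack
  · exfalso
    obtain ⟨e, he, hd⟩ := hle
    have := hν₂ e he
    have := norDeg_le_tdeg Nor e
    omega
  · have hcard : 2 * Nor.card ≤ ν := by
      have : Nor.card ≤ 4 := by simpa using Finset.card_le_univ Nor
      omega
    exact ordLE_eight_of_allSlackLE_drop hL hch hN hN' hν₁ hν₂ hcard hslack hbud

/-- EQUI-ω CHAINS: chains of blow-ups of permissible coordinate centres (any dimension), each ω-permissible at its base point (`ρ = ν_Z`), recorded with a residual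
decomposition and its minimal normal degree at every step. [OURS · L1 W4.5a] -/
inductive EquiReachable (S₀ : Stage k) : Stage k → Prop
  | refl : EquiReachable S₀ S₀
  | step {S S' : Stage k} (Nor : Finset Letter) (L : Letter) (α : Expo) (N : YPoly k) (ν : ℕ) :
      EquiReachable S₀ S → L ∈ Nor → IsChart S Nor L S' → IsResidual S.Exc S.D α N →
      (∃ e ∈ N.support, norDeg Nor e = ν) → (∀ e ∈ N.support, ν ≤ norDeg Nor e) → (∃ e ∈ N.support, tdeg e = ν) →
        EquiReachable S₀ S'

/-- Along an equi-ω chain from an exceptional-free stage every residual decomposition of every stage is `EquiTame`. [OURS · plumbing] -/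
theorem equiTame_of_equiReachable {S₀ S : Stage k} (hExc : S₀.Exc = ∅) (h : EquiReachable S₀ S)
    {α : Expo} {N : YPoly k} (hres : IsResidual S.Exc S.D α N) : EquiTame S α N := by
  induction h generalizing α N with
  | refl => right; intro n hn; rw [hExc] at hn; exact absurd hn (Finset.notMem_empty n)
  | @step S S' Nor L α₀ N₀ ν hprev hL hch hres₀ hν₁ hν₂ hequi ih =>
    exact equiTame_step hL hch hres₀ hres hν₁ hν₂ hequi (ih hres₀)

/-- ★★★ EQUI-ω CHAINS ARE TAME: from a stage WITHOUT exceptional letters, along any chain of ω-permissible blow-ups of permissible coordinate centres of any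
dimension, a final ω-permissible blow-up to a stage with the DROP-POINT BUDGET has `ord₀ N ≤ 8` for every residual decomposition — MC-8ᶜ for the equi-ω rules, in the
kernel, with no canonicity input beyond ω-permissibility. [OURS · L1 W4.5a] -/
theorem equiChain_cap {S₀ S T : Stage k} {Nor : Finset Letter} {L : Letter} {α αT : Expo} {N NT : YPoly k} {ν : ℕ} (hExc : S₀.Exc = ∅)
    (hreach : EquiReachable S₀ S) (hL : L ∈ Nor) (hch : IsChart S Nor L T)
    (hres : IsResidual S.Exc S.D α N) (hν₁ : ∃ e ∈ N.support, norDeg Nor e = ν) (hν₂ : ∀ e ∈ N.support, ν ≤ norDeg Nor e)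
    (hequi : ∃ e ∈ N.support, tdeg e = ν)
    (hresT : IsResidual T.Exc T.D αT NT) (hbud : ∃ f ∈ T.D.support, (tdeg f : ℤ) ≤ 8 + 2 * ∑ n ∈ T.Exc, T.d n) : OrdLE NT 8 :=
  ordLE_eight_of_equiTame_drop hL hch hres hresT hν₁ hν₂ hequi (equiTame_of_equiReachable hExc hreach hres) hbud

end Summit.ResolutionOfSingularities.ResolutionOfSingularities.Theorems.FInjectiveMacaulayfication.LastCentreEquiChain

end
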